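import Mathlib
import Literature.Analysis.Calculus.PolarCoordinatesE3
import HarnessLib

/-!
# Crux `OneBodyEntropyBound` (stmt-AtomisticToContinuum-13440), line `registered`: stub `stub_cagingBound`

ONE-BODY CAGING BOUND for the dilute Bose gas (worker file, `--supports stmt-AtomisticToContinuum-13440`).
Given the LOCAL NEUMANN CUBE BOUND (hypothesis; the neighbouring stub `stub_cubeNeumannBound`) and a radial
profile `v : ℝ → ℝ≥0∞` that is not a.e. zero on `(0,∞)`, there are `R, β > 0` depending on `v` only such that a
particle with wave function `φ` moving among frozen scatterers `Y j` (`j ∈ S`, arbitrary finite configuration)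
pays at least `β` per unit of probability of being within distance `R` of a scatterer:
`β ∫_{⋃ⱼ B(Y j, R)} |φ|² ≤ ∫_T (∑ₖ |∂ₖφ|² + (∑ⱼ v(|x − Y j|)) |φ|²)` for every measurable `T ⊇ ⋃ⱼ B(Y j, 7R)`.

Proof (helpers in namespace `Caging`): (0) a level set `S₀ = {r ∈ (0, R] | c₀ ≤ v r}` of positive length
(`exists_levelSet_pos`); (1) the shells `{x | |x − y| ∈ S₀}` all have the same positive volume, by translation
invariance and polar coordinates (`Literature.Analysis.Calculus.lintegral_radial_eq`), whence `σ₀ > 0`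
(`exists_shellVolume`); (2) the cube bound with `ℓ = 5R`, `c = c₀`, `σ₀` gives `ε₀`, and `β = ε₀ / 125`;
(3) lattice cubes of side `R`, one representative scatterer per occupied cube
(`Finset.exists_subset_injOn_image_eq_of_surjOn`); the `2R`-fattened cubes (side `5R`) contain the balls
`B(Y j, R)` and the shells of their points, lie in `B(Y j, 7R) ⊆ T`, and cover every point at most `125` times
(coordinate lemmas `coord_of_mem_closedBall`, `dist_lt_of_coord`, `mem_Icc_of_coord`, `sum_indicator_le_card_mul`);
(4) bookkeeping of lower Lebesgue integrals (`sum_setLIntegral_le`). Elementary; `[folklore]` throughout; no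
definitions.
-/

noncomputable section

namespace Summit.AtomisticToContinuum.BoseEinsteinCondensation.Cruxes.OneBodyEntropyBound.Birth

open MeasureTheory Set Metric Filter
open scoped ENNReal NNReal

namespace Caging

/-! ### Lower-Lebesgue-integral bookkeeping and counting -/

/-- Finite superadditivity of the lower Lebesgue integral: `∑ⱼ ∫ fⱼ ≤ ∫ ∑ⱼ fⱼ` (no measurability needed).
[folklore] -/
theorem sum_lintegral_le {α ι : Type*} [MeasurableSpace α] (μ : Measure α) (s : Finset ι)
    (f : ι → α → ℝ≥0∞) : ∑ j ∈ s, ∫⁻ x, f j x ∂μ ≤ ∫⁻ x, ∑ j ∈ s, f j x ∂μ := by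
  classical
  induction s using Finset.induction_on with
  | empty => simp
  | insert a s ha ih =>
    rw [Finset.sum_insert ha]
    calc ∫⁻ x, f a x ∂μ + ∑ j ∈ s, ∫⁻ x, f j x ∂μ
        ≤ ∫⁻ x, f a x ∂μ + ∫⁻ x, ∑ j ∈ s, f j x ∂μ := by gcongr
      _ ≤ ∫⁻ x, (f a x + ∑ j ∈ s, f j x) ∂μ := le_lintegral_add _ _
      _ = ∫⁻ x, ∑ j ∈ insert a s, f j x ∂μ := by simp [Finset.sum_insert ha]

/-- Subadditivity of set integrals over finite unions: `∫_{⋃ⱼ tⱼ} f ≤ ∑ⱼ ∫_{tⱼ} f`. [folklore] -/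
theorem lintegral_biUnion_finset_le {α ι : Type*} [MeasurableSpace α] (μ : Measure α) (s : Finset ι)
    (t : ι → Set α) (f : α → ℝ≥0∞) :
    ∫⁻ x in ⋃ j ∈ s, t j, f x ∂μ ≤ ∑ j ∈ s, ∫⁻ x in t j, f x ∂μ := by
  classical
  induction s using Finset.induction_on with
  | empty => simp
  | insert a s ha ih =>
    rw [Finset.sum_insert ha, Finset.set_biUnion_insert]
    exact (lintegral_union_le _ _ _).trans (by gcongr)

/-- LOCALISED SUMS: if the `U j ⊆ T` (`j ∈ s`) are measurable and `∑ⱼ 1_{U j} gⱼ ≤ F` on `T`, then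
`∑ⱼ ∫_{U j} gⱼ ≤ ∫_T F`. [folklore] -/
theorem sum_setLIntegral_le {α ι : Type*} [MeasurableSpace α] (μ : Measure α) (s : Finset ι)
    (U : ι → Set α) (hU : ∀ j ∈ s, MeasurableSet (U j)) (T : Set α) (hT : MeasurableSet T)
    (hUT : ∀ j ∈ s, U j ⊆ T) (g : ι → α → ℝ≥0∞) (F : α → ℝ≥0∞)
    (hpt : ∀ x ∈ T, ∑ j ∈ s, (U j).indicator (g j) x ≤ F x) :
    ∑ j ∈ s, ∫⁻ x in U j, g j x ∂μ ≤ ∫⁻ x in T, F x ∂μ := by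
  calc ∑ j ∈ s, ∫⁻ x in U j, g j x ∂μ = ∑ j ∈ s, ∫⁻ x, (U j).indicator (g j) x ∂μ :=
        Finset.sum_congr rfl fun j hj => (lintegral_indicator (hU j hj) _).symm
    _ ≤ ∫⁻ x, ∑ j ∈ s, (U j).indicator (g j) x ∂μ := sum_lintegral_le μ s _
    _ ≤ ∫⁻ x, T.indicator F x ∂μ := by
        refine lintegral_mono fun x => ?_
        by_cases hx : x ∈ T
        · rw [indicator_of_mem hx]
          exact hpt x hx
        · rw [Finset.sum_eq_zero fun j hj => indicator_of_notMem (fun h => hx (hUT j hj h)) (g j)]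
          exact zero_le
    _ = ∫⁻ x in T, F x ∂μ := lintegral_indicator hT _

/-- MULTIPLICITY COUNT: if `x ∈ U j` forces the label `P j` into a fixed finset `B` and the labels are pairwise
distinct on `s`, then `∑ⱼ 1_{U j} f (x) ≤ |B| · f x`. [folklore] -/
theorem sum_indicator_le_card_mul {ι κ α : Type*} (s : Finset ι) (U : ι → Set α) (P : ι → κ)
    (hP : Set.InjOn P s) (B : Finset κ) (x : α) (hB : ∀ j ∈ s, x ∈ U j → P j ∈ B) (f : α → ℝ≥0∞) :
    ∑ j ∈ s, (U j).indicator f x ≤ B.card * f x := by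
  classical
  simp only [Set.indicator_apply]
  rw [← Finset.sum_filter, Finset.sum_const, nsmul_eq_mul]
  gcongr
  exact_mod_cast Finset.card_le_card_of_injOn P
    (fun j hj => Finset.mem_coe.2 (hB j (Finset.mem_filter.1 hj).1 (Finset.mem_filter.1 hj).2))
    (hP.mono (Finset.coe_subset.2 (Finset.filter_subset _ _)))

/-! ### Step 0: a level set of the potential of positive length -/

/-- If `v` is not a.e. zero on `(0,∞)`, some level set `S₀ = {r ∈ (0, R] | c ≤ v r}` (`R = n+1`, `c = 1/(n+1)`)
has positive Lebesgue measure. [folklore] -/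
theorem exists_levelSet_pos (v : ℝ → ℝ≥0∞) (hv : Measurable v)
    (h : ¬ ∀ᵐ r : ℝ ∂(volume.restrict (Ioi (0 : ℝ))), v r = 0) :
    ∃ R c : ℝ, 0 < R ∧ 0 < c ∧ ∃ S₀ : Set ℝ, MeasurableSet S₀ ∧ S₀ ⊆ Ioc 0 R ∧ volume S₀ ≠ 0 ∧
      ∀ r ∈ S₀, ENNReal.ofReal c ≤ v r := by
  set E : ℕ → Set ℝ := fun n => Ioc (0 : ℝ) (n + 1) ∩ {r | ENNReal.ofReal ((n : ℝ) + 1)⁻¹ ≤ v r}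
    with hE
  have hcover : {r | v r ≠ 0} ∩ Ioi 0 ⊆ ⋃ n, E n := by
    rintro r ⟨hr, hr0⟩
    obtain ⟨n₁, hn₁⟩ := exists_nat_ge r
    obtain ⟨n₂, hn₂⟩ := ENNReal.exists_inv_nat_lt hr
    refine mem_iUnion.2 ⟨max n₁ n₂, ⟨hr0, ?_⟩, ?_⟩
    · calc r ≤ n₁ := hn₁
        _ ≤ ((max n₁ n₂ : ℕ) : ℝ) := by exact_mod_cast le_max_left _ _
        _ ≤ _ := le_add_of_nonneg_right zero_le_one
    · show ENNReal.ofReal (((max n₁ n₂ : ℕ) : ℝ) + 1)⁻¹ ≤ v r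
      refine le_trans ?_ hn₂.le
      rw [ENNReal.ofReal_inv_of_pos (by positivity)]
      apply ENNReal.inv_le_inv.2
      rw [← Nat.cast_succ, ENNReal.ofReal_natCast]
      exact_mod_cast (le_max_right n₁ n₂).trans (Nat.le_succ _)
  have hpos : volume ({r | v r ≠ 0} ∩ Ioi 0) ≠ 0 := by
    intro h0
    apply h
    rw [ae_iff, Measure.restrict_apply' measurableSet_Ioi]
    exact h0
  have hU : volume (⋃ n, E n) ≠ 0 := fun h0 => hpos (measure_mono_null hcover h0)
  rw [Ne, measure_iUnion_null_iff, not_forall] at hU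
  obtain ⟨n, hn⟩ := hU
  refine ⟨(n : ℝ) + 1, ((n : ℝ) + 1)⁻¹, by positivity, by positivity, E n, ?_, inter_subset_left, hn,
    fun r hr => hr.2⟩
  exact measurableSet_Ioc.inter (measurableSet_le measurable_const hv)

/-! ### Step 1: the spherical shells `{x | dist x y ∈ S₀}` and their common volume -/

/-- Shells with measurable radial profile are measurable. [folklore] -/
theorem measurableSet_shell {S₀ : Set ℝ} (hS : MeasurableSet S₀) (y : EuclideanSpace ℝ (Fin 3)) :
    MeasurableSet {x : EuclideanSpace ℝ (Fin 3) | dist x y ∈ S₀} :=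
  (continuous_id.dist continuous_const).measurable hS

/-- Translation invariance: the volume of a shell does not depend on its centre. [folklore] -/
theorem volume_shell (S₀ : Set ℝ) (y : EuclideanSpace ℝ (Fin 3)) :
    volume {x : EuclideanSpace ℝ (Fin 3) | dist x y ∈ S₀} = volume {x : EuclideanSpace ℝ (Fin 3) | ‖x‖ ∈ S₀} := by
  have : {x : EuclideanSpace ℝ (Fin 3) | dist x y ∈ S₀} =
      (fun x => x + (-y)) ⁻¹' {x : EuclideanSpace ℝ (Fin 3) | ‖x‖ ∈ S₀} := by
    ext x; simp [dist_eq_norm, sub_eq_add_neg]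
  rw [this, measure_preimage_add_right]

/-- Polar coordinates (`∫ F(‖x‖) dx = σ(S²) ∫₀^∞ F(r) r² dr`): the shell `{x | ‖x‖ ∈ S₀}` has positive volume as
soon as `S₀ ⊆ (0,∞)` has positive length. [folklore] -/
theorem volume_normShell_ne_zero (S₀ : Set ℝ) (hS : MeasurableSet S₀) (hS0 : S₀ ⊆ Ioi 0)
    (hvol : volume S₀ ≠ 0) : volume {x : EuclideanSpace ℝ (Fin 3) | ‖x‖ ∈ S₀} ≠ 0 := by
  have hF : Measurable (S₀.indicator (1 : ℝ → ℝ≥0∞)) := measurable_one.indicator hS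
  have hL : ∫⁻ x : EuclideanSpace ℝ (Fin 3), S₀.indicator (1 : ℝ → ℝ≥0∞) ‖x‖ =
      volume {x : EuclideanSpace ℝ (Fin 3) | ‖x‖ ∈ S₀} := by
    have h1 : ∀ x : EuclideanSpace ℝ (Fin 3), S₀.indicator (1 : ℝ → ℝ≥0∞) ‖x‖ =
        ((fun x : EuclideanSpace ℝ (Fin 3) => ‖x‖) ⁻¹' S₀).indicator 1 x :=
      fun x => by rw [← Set.indicator_comp_right (fun x : EuclideanSpace ℝ (Fin 3) => ‖x‖)]; rfl
    simp_rw [h1]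
    rw [lintegral_indicator_one (measurable_norm hS)]
    rfl
  rw [← hL, Literature.Analysis.Calculus.lintegral_radial_eq _ hF]
  refine mul_ne_zero ?_ ?_
  · rw [Measure.toSphere_apply_univ]
    exact mul_ne_zero (by simp) (measure_ball_pos volume _ one_pos).ne'
  · refine ((setLIntegral_pos_iff (hF.mul (by fun_prop))).2 ?_).ne'
    have hsub : S₀ ⊆ Function.support
        (fun r => S₀.indicator (1 : ℝ → ℝ≥0∞) r * ENNReal.ofReal (r ^ 2)) ∩ Ioi 0 := fun r hr =>
      ⟨by rw [Function.mem_support, indicator_of_mem hr]; simpa using (mem_Ioi.1 (hS0 hr)).ne', hS0 hr⟩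
    exact pos_iff_ne_zero.2 fun h0 => hvol (measure_mono_null hsub h0)

/-- SHELL VOLUME: a common positive lower bound `σ₀` for the volumes of all shells of a profile `S₀ ⊆ (0, R]` of
positive length. [folklore] -/
theorem exists_shellVolume (S₀ : Set ℝ) (R : ℝ) (hS : MeasurableSet S₀) (hS0 : S₀ ⊆ Ioc 0 R)
    (hvol : volume S₀ ≠ 0) : ∃ σ₀ : ℝ, 0 < σ₀ ∧
      ∀ y : EuclideanSpace ℝ (Fin 3), ENNReal.ofReal σ₀ ≤ volume {x : EuclideanSpace ℝ (Fin 3) | dist x y ∈ S₀} := by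
  have h0 := volume_normShell_ne_zero S₀ hS (fun r hr => (hS0 hr).1) hvol
  have hsub : {x : EuclideanSpace ℝ (Fin 3) | ‖x‖ ∈ S₀} ⊆ closedBall 0 R := fun x hx =>
    mem_closedBall_zero_iff.2 (hS0 hx).2
  have htop := ((measure_mono hsub).trans_lt (measure_closedBall_lt_top (μ := volume))).ne
  refine ⟨_, ENNReal.toReal_pos h0 htop, fun y => ?_⟩
  rw [volume_shell]
  exact ENNReal.ofReal_toReal_le

/-! ### Step 3: lattice geometry in coordinates

A scatterer `y` sits in the lattice cube `∏ₖ [p_k R, p_k R + R)`, `p_k = ⌊y_k / R⌋`; its FATTENED CUBE is the open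
cube `∏ₖ (p_k R − 2R, p_k R − 2R + 5R)` of side `5R`. -/

/-- `⌊t/R⌋ R ≤ t < ⌊t/R⌋ R + R`. [folklore] -/
theorem floor_bounds {R : ℝ} (hR : 0 < R) (t : ℝ) : (⌊t / R⌋ : ℝ) * R ≤ t ∧ t < (⌊t / R⌋ : ℝ) * R + R := by
  constructor
  · exact (le_div_iff₀ hR).1 (Int.floor_le _)
  · have := (div_lt_iff₀ hR).1 (Int.lt_floor_add_one (t / R))
    linarith

/-- The closed ball `B̄(y, R)` lies in the fattened cube of `y` (coordinatewise). [folklore] -/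
theorem coord_of_mem_closedBall {R : ℝ} (hR : 0 < R) {p : Fin 3 → ℤ} {x y : EuclideanSpace ℝ (Fin 3)}
    (hy : ∀ k, (p k : ℝ) * R ≤ y k ∧ y k < (p k : ℝ) * R + R) (hx : x ∈ closedBall y R) (k : Fin 3) :
    (p k : ℝ) * R - 2 * R < x k ∧ x k < (p k : ℝ) * R - 2 * R + 5 * R := by
  obtain ⟨h1, h2⟩ := hy k
  have h3 : |x k - y k| ≤ R :=
    (Real.dist_eq (x k) (y k)) ▸ (PiLp.dist_apply_le x y k).trans (mem_closedBall.1 hx)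
  rw [abs_le] at h3
  constructor <;> linarith [h3.1, h3.2]

/-- The fattened cube of `y` lies in `B(y, 7R)` (`3√3 < 7`). [folklore] -/
theorem dist_lt_of_coord {R : ℝ} (hR : 0 < R) {p : Fin 3 → ℤ} {x y : EuclideanSpace ℝ (Fin 3)}
    (hy : ∀ k, (p k : ℝ) * R ≤ y k ∧ y k < (p k : ℝ) * R + R)
    (hx : ∀ k, (p k : ℝ) * R - 2 * R < x k ∧ x k < (p k : ℝ) * R - 2 * R + 5 * R) : dist x y < 7 * R := by
  rw [EuclideanSpace.dist_eq]
  have hk : ∀ k, dist (x k) (y k) ^ 2 ≤ (3 * R) ^ 2 := fun k => by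
    obtain ⟨h1, h2⟩ := hy k
    obtain ⟨h3, h4⟩ := hx k
    rw [Real.dist_eq, sq_abs]
    apply sq_le_sq' <;> linarith
  have hsum : ∑ k, dist (x k) (y k) ^ 2 ≤ 3 * (3 * R) ^ 2 :=
    calc ∑ k, dist (x k) (y k) ^ 2 ≤ ∑ _k : Fin 3, (3 * R) ^ 2 := Finset.sum_le_sum fun k _ => hk k
      _ = 3 * (3 * R) ^ 2 := by simp
  calc Real.sqrt (∑ k, dist (x k) (y k) ^ 2) ≤ Real.sqrt (3 * (3 * R) ^ 2) := Real.sqrt_le_sqrt hsum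
    _ < 7 * R := by
      rw [Real.sqrt_lt' (by positivity)]
      nlinarith [mul_pos hR hR]

/-- MULTIPLICITY: a point `x` meets the fattened cube of `p` only if `p` lies in the `5 × 5 × 5` box of lattice
points around `(⌊x_k / R⌋)_k`. [folklore] -/
theorem mem_Icc_of_coord {R : ℝ} (hR : 0 < R) {p : Fin 3 → ℤ} {x : EuclideanSpace ℝ (Fin 3)}
    (hx : ∀ k, (p k : ℝ) * R - 2 * R < x k ∧ x k < (p k : ℝ) * R - 2 * R + 5 * R) :
    p ∈ Finset.Icc (fun k => ⌊x k / R⌋ - 2) (fun k => ⌊x k / R⌋ + 2) := by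
  simp only [Finset.mem_Icc, Pi.le_def]
  refine ⟨fun k => ?_, fun k => ?_⟩ <;> obtain ⟨h1, h2⟩ := hx k
  · have : ⌊x k / R⌋ < p k + 3 := Int.floor_lt.2 (by push_cast; rw [div_lt_iff₀ hR]; linarith)
    omega
  · have : p k - 2 ≤ ⌊x k / R⌋ := Int.le_floor.2 (by push_cast; rw [le_div_iff₀ hR]; linarith)
    omega

/-- The `5 × 5 × 5` box of lattice points has `125` elements. [folklore] -/
theorem card_Icc_box (q : Fin 3 → ℤ) :
    (Finset.Icc (fun k => q k - 2) (fun k => q k + 2)).card = 125 := by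
  rw [Pi.card_Icc]
  have : ∀ k : Fin 3, (Finset.Icc (q k - 2) (q k + 2)).card = 5 := fun k => by
    rw [Int.card_Icc, show q k + 2 + 1 - (q k - 2) = 5 by ring]; rfl
  simp [this]

/-- Open coordinate cubes (the cubes of the local Neumann bound) are measurable. [folklore] -/
theorem measurableSet_box (a : EuclideanSpace ℝ (Fin 3)) (ℓ : ℝ) :
    MeasurableSet {x : EuclideanSpace ℝ (Fin 3) | ∀ k, x k ∈ Set.Ioo (a k) (a k + ℓ)} := by
  have : {x : EuclideanSpace ℝ (Fin 3) | ∀ k, x k ∈ Set.Ioo (a k) (a k + ℓ)} =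
      ⋂ k, (fun x : EuclideanSpace ℝ (Fin 3) => x k) ⁻¹' Ioo (a k) (a k + ℓ) := by
    ext x; simp
  rw [this]
  exact MeasurableSet.iInter fun k => measurableSet_Ioo.preimage (by fun_prop)

end Caging

open Caging in
/-- **ONE-BODY CAGING BOUND** (stub `stub_cagingBound` of line `registered`, given the local Neumann cube bound):
if the radial profile `v` is not a.e. zero on `(0,∞)`, there are `R, β > 0` (depending on `v` only) such that for
every finite family of scatterers `Y j` (`j ∈ S`), every measurable `T ⊇ ⋃ⱼ B(Y j, 7R)` and every `C¹` compactly
supported `φ`, `β ∫_{⋃ⱼ B(Y j, R)} |φ|² ≤ ∫_T (|∇φ|² + (∑ⱼ v(|x − Y j|)) |φ|²)`. Proof: level set `S₀ ⊆ (0,R]` of `v`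
of positive length (`c₀ ≤ v` on `S₀`), shells `{|x − Y j| ∈ S₀}` of volume `≥ σ₀ > 0`, one representative
scatterer per occupied lattice cube of side `R`, the cube bound on the `2R`-fattened cubes (side `5R`, multiplicity
`≤ 125`), `β = ε₀ / 125`. [folklore] -/
theorem stub_cagingBound :
    (∀ (ℓ c σ₀ : ℝ), 0 < ℓ → 0 < c → 0 < σ₀ → ∃ ε₀ : ℝ, 0 < ε₀ ∧
      ∀ (a : EuclideanSpace ℝ (Fin 3)) (Sh : Set (EuclideanSpace ℝ (Fin 3))), MeasurableSet Sh →
        Sh ⊆ {x | ∀ k, x k ∈ Set.Ioo (a k) (a k + ℓ)} → ENNReal.ofReal σ₀ ≤ MeasureTheory.volume Sh →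
        ∀ φ : EuclideanSpace ℝ (Fin 3) → ℂ, ContDiff ℝ 1 φ → HasCompactSupport φ →
          ENNReal.ofReal ε₀ * ∫⁻ x in {x | ∀ k, x k ∈ Set.Ioo (a k) (a k + ℓ)}, (‖φ x‖₊ : ENNReal) ^ 2 ≤
            (∫⁻ x in {x | ∀ k, x k ∈ Set.Ioo (a k) (a k + ℓ)},
                ∑ k : Fin 3, (‖fderiv ℝ φ x (EuclideanSpace.single k (1 : ℝ))‖₊ : ENNReal) ^ 2) +
              ENNReal.ofReal c * ∫⁻ x in Sh, (‖φ x‖₊ : ENNReal) ^ 2) →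
    ∀ v : ℝ → ENNReal, Measurable v →
      (¬ ∀ᵐ r : ℝ ∂(MeasureTheory.volume.restrict (Set.Ioi (0 : ℝ))), v r = 0) →
      ∃ R : ℝ, 0 < R ∧ ∃ β : ℝ, 0 < β ∧
        ∀ (m : ℕ) (Y : Fin m → EuclideanSpace ℝ (Fin 3)) (S : Finset (Fin m))
          (T : Set (EuclideanSpace ℝ (Fin 3))), MeasurableSet T →
          (∀ j ∈ S, Metric.ball (Y j) (7 * R) ⊆ T) →
          ∀ φ : EuclideanSpace ℝ (Fin 3) → ℂ, ContDiff ℝ 1 φ → HasCompactSupport φ →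
            ENNReal.ofReal β * ∫⁻ x in ⋃ j ∈ S, Metric.ball (Y j) R, (‖φ x‖₊ : ENNReal) ^ 2 ≤
              ∫⁻ x in T, ((∑ k : Fin 3, (‖fderiv ℝ φ x (EuclideanSpace.single k (1 : ℝ))‖₊ : ENNReal) ^ 2) +
                (∑ j ∈ S, v (dist x (Y j))) * (‖φ x‖₊ : ENNReal) ^ 2) := by
  intro hcube v hv hae
  -- Step 0: a level set `S₀ ⊆ (0, R]` of positive length with `c₀ ≤ v` on `S₀`.
  obtain ⟨R, c₀, hR, hc₀, S₀, hS₀m, hS₀sub, hS₀vol, hS₀v⟩ := exists_levelSet_pos v hv hae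
  -- Step 1: the shells of profile `S₀` have volume `≥ σ₀ > 0`.
  obtain ⟨σ₀, hσ₀, hσvol⟩ := exists_shellVolume S₀ R hS₀m hS₀sub hS₀vol
  -- Step 2: the cube bound on cubes of side `5R`; `β = ε₀ / 125`.
  obtain ⟨ε₀, hε₀, hbound⟩ := hcube (5 * R) c₀ σ₀ (by positivity) hc₀ hσ₀
  refine ⟨R, hR, ε₀ / 125, by positivity, ?_⟩
  intro m Y S T hT hballT φ hφ hφc
  set H : EuclideanSpace ℝ (Fin 3) → ℝ≥0∞ := fun x => (‖φ x‖₊ : ℝ≥0∞) ^ 2 with hH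
  set G : EuclideanSpace ℝ (Fin 3) → ℝ≥0∞ := fun x =>
    ∑ k : Fin 3, (‖fderiv ℝ φ x (EuclideanSpace.single k (1 : ℝ))‖₊ : ℝ≥0∞) ^ 2 with hG
  show ENNReal.ofReal (ε₀ / 125) * ∫⁻ x in ⋃ j ∈ S, ball (Y j) R, H x ≤
    ∫⁻ x in T, (G x + (∑ j ∈ S, v (dist x (Y j))) * H x)
  -- Step 3: lattice index `idx`, fattened cubes `U p` of corner `crn p`, one representative scatterer per
  -- occupied lattice cube (`S' ⊆ S`, `idx ∘ Y` injective on `S'` with the same image).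
  set idx : EuclideanSpace ℝ (Fin 3) → (Fin 3 → ℤ) := fun y k => ⌊y k / R⌋ with hidx
  set crn : (Fin 3 → ℤ) → EuclideanSpace ℝ (Fin 3) := fun p => WithLp.toLp 2 fun k => (p k : ℝ) * R - 2 * R
    with hcrn
  set U : (Fin 3 → ℤ) → Set (EuclideanSpace ℝ (Fin 3)) := fun p =>
    {x | ∀ k, x k ∈ Set.Ioo (crn p k) (crn p k + 5 * R)} with hUdef
  have hidxb : ∀ (y : EuclideanSpace ℝ (Fin 3)) k, (idx y k : ℝ) * R ≤ y k ∧ y k < (idx y k : ℝ) * R + R :=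
    fun y k => floor_bounds hR (y k)
  have hmemU : ∀ p x, x ∈ U p ↔ ∀ k, (p k : ℝ) * R - 2 * R < x k ∧ x k < (p k : ℝ) * R - 2 * R + 5 * R :=
    fun p x => Iff.rfl
  have hballU : ∀ y, ball y R ⊆ U (idx y) := fun y x hx =>
    (hmemU _ _).2 fun k => coord_of_mem_closedBall hR (hidxb y) (ball_subset_closedBall hx) k
  have hShU : ∀ y, {x | dist x y ∈ S₀} ⊆ U (idx y) := fun y x hx =>
    (hmemU _ _).2 fun k => coord_of_mem_closedBall hR (hidxb y) (mem_closedBall.2 (hS₀sub hx).2) k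
  have hUball : ∀ y, U (idx y) ⊆ ball y (7 * R) := fun y x hx =>
    mem_ball.2 (dist_lt_of_coord hR (hidxb y) ((hmemU _ _).1 hx))
  classical
  obtain ⟨S', hS'S, hinj, himg⟩ := Finset.exists_subset_injOn_image_eq_of_surjOn (S : Set (Fin m))
    (S.image fun j => idx (Y j)) (by rw [Finset.coe_image]; exact surjOn_image _ _)
  replace hS'S : S' ⊆ S := Finset.coe_subset.1 hS'S
  have hU_T : ∀ j ∈ S', U (idx (Y j)) ⊆ T := fun j hj => (hUball (Y j)).trans (hballT j (hS'S hj))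
  have hcover : (⋃ j ∈ S, ball (Y j) R) ⊆ ⋃ j ∈ S', U (idx (Y j)) := by
    intro x hx
    simp only [mem_iUnion, exists_prop] at hx ⊢
    obtain ⟨j, hj, hxj⟩ := hx
    obtain ⟨j', hj', hjj'⟩ := Finset.mem_image.1 (himg ▸ Finset.mem_image_of_mem (fun j => idx (Y j)) hj)
    refine ⟨j', hj', ?_⟩
    have e : idx (Y j') = idx (Y j) := hjj'
    rw [e]
    exact hballU (Y j) hxj
  have hmult : ∀ (f : EuclideanSpace ℝ (Fin 3) → ℝ≥0∞) x, ∑ j ∈ S', (U (idx (Y j))).indicator f x ≤ 125 * f x :=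
    fun f x => by
    have h := sum_indicator_le_card_mul S' (fun j => U (idx (Y j))) (fun j => idx (Y j)) hinj
      (Finset.Icc (fun k => idx x k - 2) (fun k => idx x k + 2)) x
      (fun j _ hj => mem_Icc_of_coord hR ((hmemU _ _).1 hj)) f
    rwa [card_Icc_box, Nat.cast_ofNat] at h
  -- Step 4: the chain of inequalities.
  have h1 : ∫⁻ x in ⋃ j ∈ S, ball (Y j) R, H x ≤ ∑ j ∈ S', ∫⁻ x in U (idx (Y j)), H x :=
    (lintegral_mono_set hcover).trans (lintegral_biUnion_finset_le _ _ _ _)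
  have h2 : ∀ j ∈ S', ENNReal.ofReal ε₀ * ∫⁻ x in U (idx (Y j)), H x ≤
      (∫⁻ x in U (idx (Y j)), G x) + ENNReal.ofReal c₀ * ∫⁻ x in {x | dist x (Y j) ∈ S₀}, H x :=
    fun j _ => hbound (crn (idx (Y j))) {x | dist x (Y j) ∈ S₀} (measurableSet_shell hS₀m _)
      (hShU (Y j)) (hσvol (Y j)) φ hφ hφc
  have h3 : ∑ j ∈ S', ∫⁻ x in U (idx (Y j)), G x ≤ 125 * ∫⁻ x in T, G x := by
    rw [← lintegral_const_mul' _ _ (by simp)]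
    exact sum_setLIntegral_le volume S' (fun j => U (idx (Y j))) (fun j _ => measurableSet_box _ _) T hT
      hU_T (fun _ => G) _ (fun x _ => hmult G x)
  have h4 : ∑ j ∈ S', ENNReal.ofReal c₀ * ∫⁻ x in {x | dist x (Y j) ∈ S₀}, H x ≤
      ∫⁻ x in T, (∑ j ∈ S, v (dist x (Y j))) * H x := by
    simp_rw [← lintegral_const_mul' _ _ ENNReal.ofReal_ne_top]
    refine sum_setLIntegral_le volume S' (fun j => {x | dist x (Y j) ∈ S₀})
      (fun j _ => measurableSet_shell hS₀m _) T hT (fun j hj => (hShU (Y j)).trans (hU_T j hj))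
      (fun _ x => ENNReal.ofReal c₀ * H x) _ fun x _ => ?_
    rw [Finset.sum_mul]
    refine (Finset.sum_le_sum fun j _ => ?_).trans (Finset.sum_le_sum_of_subset hS'S)
    by_cases hxj : x ∈ {x | dist x (Y j) ∈ S₀}
    · rw [indicator_of_mem hxj]
      exact mul_le_mul_left (hS₀v _ hxj) _
    · rw [indicator_of_notMem hxj]
      exact zero_le
  have key : ENNReal.ofReal ε₀ * ∑ j ∈ S', ∫⁻ x in U (idx (Y j)), H x ≤
      125 * (∫⁻ x in T, G x) + ∫⁻ x in T, (∑ j ∈ S, v (dist x (Y j))) * H x :=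
    calc ENNReal.ofReal ε₀ * ∑ j ∈ S', ∫⁻ x in U (idx (Y j)), H x
        = ∑ j ∈ S', ENNReal.ofReal ε₀ * ∫⁻ x in U (idx (Y j)), H x := Finset.mul_sum _ _ _
      _ ≤ ∑ j ∈ S', ((∫⁻ x in U (idx (Y j)), G x) +
            ENNReal.ofReal c₀ * ∫⁻ x in {x | dist x (Y j) ∈ S₀}, H x) := Finset.sum_le_sum h2
      _ = (∑ j ∈ S', ∫⁻ x in U (idx (Y j)), G x) +
            ∑ j ∈ S', ENNReal.ofReal c₀ * ∫⁻ x in {x | dist x (Y j) ∈ S₀}, H x := Finset.sum_add_distrib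
      _ ≤ _ := add_le_add h3 h4
  have hβ : ENNReal.ofReal (ε₀ / 125) = 125⁻¹ * ENNReal.ofReal ε₀ := by
    rw [ENNReal.ofReal_div_of_pos (by norm_num), ENNReal.ofReal_ofNat, div_eq_mul_inv, mul_comm]
  calc ENNReal.ofReal (ε₀ / 125) * ∫⁻ x in ⋃ j ∈ S, ball (Y j) R, H x
      ≤ ENNReal.ofReal (ε₀ / 125) * ∑ j ∈ S', ∫⁻ x in U (idx (Y j)), H x := by gcongr
    _ = 125⁻¹ * (ENNReal.ofReal ε₀ * ∑ j ∈ S', ∫⁻ x in U (idx (Y j)), H x) := by rw [hβ, mul_assoc]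
    _ ≤ 125⁻¹ * (125 * (∫⁻ x in T, G x) + ∫⁻ x in T, (∑ j ∈ S, v (dist x (Y j))) * H x) := by gcongr
    _ = (∫⁻ x in T, G x) + 125⁻¹ * ∫⁻ x in T, (∑ j ∈ S, v (dist x (Y j))) * H x := by
        rw [mul_add, ← mul_assoc, ENNReal.inv_mul_cancel (by norm_num) (by simp), one_mul]
    _ ≤ (∫⁻ x in T, G x) + ∫⁻ x in T, (∑ j ∈ S, v (dist x (Y j))) * H x := by
        gcongr
        exact mul_le_of_le_one_left' (ENNReal.inv_le_one.2 (by norm_num))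
    _ ≤ ∫⁻ x in T, (G x + (∑ j ∈ S, v (dist x (Y j))) * H x) := le_lintegral_add _ _

end Summit.AtomisticToContinuum.BoseEinsteinCondensation.Cruxes.OneBodyEntropyBound.Birth
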